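import Summits.Ventures.PercRepro.CoreRhoLemma

/-!
# PercRepro — counting on the core, part A: the rank-`3` sets number at most `(2 + ρ)·C(n,3)` (p2, gen 11)

Night-1's counting route to C-025 at `q = 3` (`proofs/NIGHT-1-C025-induction.md` §12, COUNTS ON THE CORE) bounds
the rank-`3` subsets `W₃` of the core (simple; (C1) lines `≤ 3` points; (C2) planes `≤ 7` points) by
`W₃ ≤ i₃ + (n − 3)·s₃ + Λ₃ ≤ (2 + ρ)·C(n,3)`, `ρ = 64/35`: a rank-`3` set is an independent triple (`i₃ ≤ C(n,3)`),
a rank-`2` triple plus one point (`(n − 3)·s₃ ≤ C(n,3)` since `3·s₃ ≤ C(n,2)`), or a cyclic rank-`3` set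
(`Λ₃ ≤ ρ·i₃` by Lemma ρ, `CoreRhoLemma.lean`, plane by plane). This file is that count over the finset vocabulary
of `RankLevelSetHCore` / `PlaneCore` (`gr`, `clF`, `planes`), with (C1) and (C2) as hypotheses on the subsets of
the ground set — exactly the conclusions of night-1's `RankLevelSetCoreSparse` — so that the core of
`rls_succ_all` instantiates it.

* `rank3Sets`, `rank3Triples`, `rank2Triples`, `linePoint`, `cyclic3` — the five families;
* `card_le_three_of_eRk_le_two` — (C1) + simplicity: a set of rank `≤ 2` has `≤ 3` points;
* `eq_of_rank_le_two_triples_global` — a `4`-set contains at most one rank-`≤ 2` triple;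
* `rank3Sets_subset` — the decomposition «rank-3 set = rank-3 triple | rank-2 triple + point | cyclic»;
* `three_mul_card_rank2Triples_le` — `3·s₃ ≤ C(n,2)`; `card_linePoint` — `s₃·(n − 3)` «triple + point» sets;
* `card_cyclic3_le_sum`, `sum_tau3_eq` — the cyclic rank-`3` sets and the rank-`3` triples, plane by plane;
* `thirtyfive_mul_card_cyclic3_le` — `35·Λ₃ ≤ 64·i₃` (Lemma ρ on every plane);
* **`thirtyfive_mul_card_rank3Sets_le`** — `35·W₃ ≤ 134·C(n,3)`, i.e. `W₃ ≤ (2 + 64/35)·C(n,3)`.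
Imports `CoreRhoLemma` (hence `PlaneCore`) only. Axioms: standard.
-/

namespace PercRepro
namespace CoreCount

open Finset ThmH RhoLemma

variable {α : Type*} [DecidableEq α] {M : Matroid α} [M.Finite]

open scoped Classical in
/-- The rank-`3` subsets of the ground set, as finsets (`W₃`). -/
noncomputable def rank3Sets (M : Matroid α) [M.Finite] : Finset (Finset α) :=
  (gr M).powerset.filter (fun (S : Finset α) => M.eRk (S : Set α) = 3)

open scoped Classical in
/-- The rank-`3` triples of the ground set (`i₃`). -/
noncomputable def rank3Triples (M : Matroid α) [M.Finite] : Finset (Finset α) :=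
  (gr M).powerset.filter (fun (T : Finset α) => T.card = 3 ∧ M.eRk (T : Set α) = 3)

open scoped Classical in
/-- The rank-`≤ 2` triples of the ground set (`s₃`, the `3`-point lines). -/
noncomputable def rank2Triples (M : Matroid α) [M.Finite] : Finset (Finset α) :=
  (gr M).powerset.filter (fun (T : Finset α) => T.card = 3 ∧ M.eRk (T : Set α) ≤ 2)

open scoped Classical in
/-- The «rank-`2` triple + one point» sets. -/
noncomputable def linePoint (M : Matroid α) [M.Finite] : Finset (Finset α) :=
  (rank2Triples M).biUnion (fun T => (gr M \ T).image (fun x => insert x T))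

open scoped Classical in
/-- The cyclic rank-`3` subsets of the ground set (`Λ₃`). -/
noncomputable def cyclic3 (M : Matroid α) [M.Finite] : Finset (Finset α) :=
  (gr M).powerset.filter (fun (S : Finset α) => M.eRk (S : Set α) = 3 ∧ 4 ≤ S.card ∧ CyclicF M S)

/-! ### Consequences of (C1) and simplicity -/

omit [DecidableEq α] in
/-- A subset of the ground set with `≥ 2` points has rank `≥ 2` (simplicity). -/
theorem two_le_eRk_of_one_lt_card (hs : Simple M) {S : Finset α} (hS : S ⊆ gr M) (h : 1 < S.card) :
    2 ≤ M.eRk (S : Set α) := by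
  obtain ⟨e, he, f, hf, hef⟩ : ∃ e ∈ S, ∃ f ∈ S, e ≠ f := Finset.one_lt_card.1 h
  exact two_le_eRk_of_ne hs hS he hf hef

omit [DecidableEq α] in
/-- **(C1) + simplicity**: a subset of the ground set of rank `≤ 2` has at most `3` points. -/
theorem card_le_three_of_eRk_le_two (hs : Simple M) (hC1 : ∀ L ⊆ gr M, M.eRk (L : Set α) = 2 → L.card ≤ 3)
    {S : Finset α} (hS : S ⊆ gr M) (hr : M.eRk (S : Set α) ≤ 2) : S.card ≤ 3 := by
  by_contra hlt
  push Not at hlt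
  have h2 := two_le_eRk_of_one_lt_card hs hS (by omega)
  have h3 : M.eRk (S : Set α) = 2 := le_antisymm hr h2
  have := hC1 S hS h3
  omega

omit [DecidableEq α] in
/-- The rank of a subset of the ground set with `≥ 4` points is `≥ 3` (under (C1) and simplicity). -/
theorem three_le_eRk_of_four_le (hs : Simple M) (hC1 : ∀ L ⊆ gr M, M.eRk (L : Set α) = 2 → L.card ≤ 3)
    {S : Finset α} (hS : S ⊆ gr M) (h4 : 4 ≤ S.card) : 3 ≤ M.eRk (S : Set α) := by
  by_contra hlt
  push Not at hlt
  obtain ⟨k, hk, -⟩ := eRk_eq_nat M S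
  rw [hk] at hlt
  have hk2 : k ≤ 2 := by
    have : k < 3 := by exact_mod_cast hlt
    omega
  have hle : M.eRk (S : Set α) ≤ 2 := by rw [hk]; exact_mod_cast hk2
  have := card_le_three_of_eRk_le_two hs hC1 hS hle
  omega

/-- **A `4`-subset of the ground set contains at most one rank-`≤ 2` triple** (else their union, the whole `4`-set,
would have rank `≤ 2` by submodularity, against (C1)). -/
theorem eq_of_rank_le_two_triples_global (hs : Simple M)
    (hC1 : ∀ L ⊆ gr M, M.eRk (L : Set α) = 2 → L.card ≤ 3)
    {S T T' : Finset α} (hS : S ⊆ gr M) (h4 : S.card = 4) (hT : T ⊆ S) (hT' : T' ⊆ S)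
    (hTc : T.card = 3) (hT'c : T'.card = 3) (hTr : M.eRk (T : Set α) ≤ 2) (hT'r : M.eRk (T' : Set α) ≤ 2) :
    T = T' := by
  by_contra hne
  have hinter : (T ∩ T').card < 3 := by
    by_contra hge
    push Not at hge
    have : T ∩ T' = T := Finset.eq_of_subset_of_card_le Finset.inter_subset_left (by omega)
    have h1 : T ⊆ T' := by rw [← this]; exact Finset.inter_subset_right
    exact hne (Finset.eq_of_subset_of_card_le h1 (by omega))
  have hunion : (T ∪ T').card + (T ∩ T').card = T.card + T'.card := Finset.card_union_add_card_inter T T'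
  have hunion_le : (T ∪ T').card ≤ 4 := by rw [← h4]; exact Finset.card_le_card (Finset.union_subset hT hT')
  have hinter2 : (T ∩ T').card = 2 := by omega
  have hTT'S : T ∪ T' = S := Finset.eq_of_subset_of_card_le (Finset.union_subset hT hT') (by omega)
  have hinterE : T ∩ T' ⊆ gr M := (Finset.inter_subset_left.trans hT).trans hS
  have hrinter : 2 ≤ M.eRk ((T ∩ T' : Finset α) : Set α) :=
    two_le_eRk_of_one_lt_card hs hinterE (by omega)
  have hsub := M.eRk_inter_add_eRk_union_le (T : Set α) (T' : Set α)
  rw [← Finset.coe_inter, ← Finset.coe_union, hTT'S] at hsub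
  -- everything in `ℕ`
  obtain ⟨a, ha, -⟩ := eRk_eq_nat M (T ∩ T')
  obtain ⟨b, hb, -⟩ := eRk_eq_nat M S
  obtain ⟨c, hc, -⟩ := eRk_eq_nat M T
  obtain ⟨c', hc', -⟩ := eRk_eq_nat M T'
  rw [ha, hb, hc, hc'] at hsub
  rw [ha] at hrinter
  rw [hc] at hTr
  rw [hc'] at hT'r
  have hsub' : a + b ≤ c + c' := by exact_mod_cast hsub
  have ha' : 2 ≤ a := by exact_mod_cast hrinter
  have hc2 : c ≤ 2 := by exact_mod_cast hTr
  have hc'2 : c' ≤ 2 := by exact_mod_cast hT'r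
  have hb2 : M.eRk (S : Set α) ≤ 2 := by rw [hb]; exact_mod_cast (show b ≤ 2 by omega)
  have := card_le_three_of_eRk_le_two hs hC1 hS hb2
  omega

/-! ### The decomposition of the rank-`3` sets -/

omit [DecidableEq α] [M.Finite] in
/-- A rank-`3` finset has at least `3` points. -/
theorem three_le_card_of_eRk_eq_three {S : Finset α} (hr : M.eRk (S : Set α) = 3) : 3 ≤ S.card := by
  have h := M.eRk_le_encard (S : Set α)
  rw [hr, Set.encard_coe_eq_coe_finsetCard] at h
  exact_mod_cast h

open scoped Classical in
/-- **The decomposition**: every rank-`3` subset of the ground set is a rank-`3` triple, a «rank-`2` triple + point»,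
or a cyclic rank-`3` set. -/
theorem rank3Sets_subset (hs : Simple M) (hC1 : ∀ L ⊆ gr M, M.eRk (L : Set α) = 2 → L.card ≤ 3) :
    rank3Sets M ⊆ rank3Triples M ∪ linePoint M ∪ cyclic3 M := by
  intro S hS
  unfold rank3Sets at hS
  rw [Finset.mem_filter, Finset.mem_powerset] at hS
  obtain ⟨hSG, hr⟩ := hS
  have h3 := three_le_card_of_eRk_eq_three hr
  rw [Finset.mem_union, Finset.mem_union]
  rcases Nat.lt_or_ge S.card 4 with hlt | h4
  · left; left
    unfold rank3Triples
    rw [Finset.mem_filter, Finset.mem_powerset]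
    exact ⟨hSG, by omega, hr⟩
  · by_cases hcyc : CyclicF M S
    · right
      unfold cyclic3
      rw [Finset.mem_filter, Finset.mem_powerset]
      exact ⟨hSG, hr, h4, hcyc⟩
    · left; right
      unfold CyclicF at hcyc
      push Not at hcyc
      obtain ⟨x, hx, hne⟩ := hcyc
      set T := S.erase x with hT_def
      have hTS : T ⊆ S := Finset.erase_subset x S
      have hTG : T ⊆ gr M := hTS.trans hSG
      have hTcard : T.card + 1 = S.card := Finset.card_erase_add_one hx
      have hTle : M.eRk (T : Set α) ≤ 3 := by rw [← hr]; exact M.eRk_mono (Finset.coe_subset.2 hTS)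
      have hTle2 : M.eRk (T : Set α) ≤ 2 := by
        obtain ⟨k, hk, -⟩ := eRk_eq_nat M T
        rw [hk] at hTle hne ⊢
        rw [hr] at hne
        have hk3 : k ≤ 3 := by exact_mod_cast hTle
        have hk3' : k ≠ 3 := by intro h; apply hne; rw [h]; rfl
        exact_mod_cast (show k ≤ 2 by omega)
      have hT3 : T.card ≤ 3 := card_le_three_of_eRk_le_two hs hC1 hTG hTle2
      have hTc : T.card = 3 := by omega
      unfold linePoint
      rw [Finset.mem_biUnion]
      refine ⟨T, ?_, ?_⟩
      · unfold rank2Triples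
        rw [Finset.mem_filter, Finset.mem_powerset]
        exact ⟨hTG, hTc, hTle2⟩
      · rw [Finset.mem_image]
        refine ⟨x, ?_, Finset.insert_erase hx⟩
        rw [Finset.mem_sdiff]
        exact ⟨hSG hx, Finset.notMem_erase x S⟩

/-! ### The three counts -/

omit [DecidableEq α] in
open scoped Classical in
/-- `i₃ ≤ C(n, 3)`. -/
theorem card_rank3Triples_le : (rank3Triples M).card ≤ Nat.choose (gr M).card 3 := by
  rw [← Finset.card_powersetCard]
  apply Finset.card_le_card
  intro T hT
  unfold rank3Triples at hT
  rw [Finset.mem_filter, Finset.mem_powerset] at hT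
  rw [Finset.mem_powersetCard]
  exact ⟨hT.1, hT.2.1⟩

open scoped Classical in
/-- **`3·s₃ ≤ C(n, 2)`**: the pairs inside the rank-`2` triples are distinct (a pair lies in at most one such triple). -/
theorem three_mul_card_rank2Triples_le (hs : Simple M)
    (hC1 : ∀ L ⊆ gr M, M.eRk (L : Set α) = 2 → L.card ≤ 3) :
    3 * (rank2Triples M).card ≤ Nat.choose (gr M).card 2 := by
  have hmem : ∀ T ∈ rank2Triples M, T ⊆ gr M ∧ T.card = 3 ∧ M.eRk (T : Set α) ≤ 2 := by
    intro T hT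
    unfold rank2Triples at hT
    rw [Finset.mem_filter, Finset.mem_powerset] at hT
    exact ⟨hT.1, hT.2.1, hT.2.2⟩
  have hdisj : ((rank2Triples M : Finset (Finset α)) : Set (Finset α)).PairwiseDisjoint
      (fun T => Finset.powersetCard 2 T) := by
    intro T hT T' hT' hne
    rw [Function.onFun, Finset.disjoint_left]
    intro P hP hP'
    rw [Finset.mem_powersetCard] at hP hP'
    obtain ⟨hTG, hTc, hTr⟩ := hmem T hT
    obtain ⟨hT'G, hT'c, hT'r⟩ := hmem T' hT'
    -- `|T ∩ T'| ≥ 2`, so `|T ∩ T'| = 2` (else `T = T'`) and `|T ∪ T'| = 4`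
    have hPsub : P ⊆ T ∩ T' := Finset.subset_inter hP.1 hP'.1
    have hinter2 : 2 ≤ (T ∩ T').card := hP.2 ▸ Finset.card_le_card hPsub
    have hinter3 : (T ∩ T').card < 3 := by
      by_contra hge
      push Not at hge
      have : T ∩ T' = T := Finset.eq_of_subset_of_card_le Finset.inter_subset_left (by omega)
      have h1 : T ⊆ T' := by rw [← this]; exact Finset.inter_subset_right
      exact hne (Finset.eq_of_subset_of_card_le h1 (by omega))
    have hunion : (T ∪ T').card + (T ∩ T').card = T.card + T'.card := Finset.card_union_add_card_inter T T'
    have h4 : (T ∪ T').card = 4 := by omega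
    exact hne (eq_of_rank_le_two_triples_global hs hC1 (Finset.union_subset hTG hT'G) h4
      Finset.subset_union_left Finset.subset_union_right hTc hT'c hTr hT'r)
  have hcard : ((rank2Triples M).biUnion (fun T => Finset.powersetCard 2 T)).card = 3 * (rank2Triples M).card := by
    rw [Finset.card_biUnion hdisj]
    have : ∀ T ∈ rank2Triples M, (Finset.powersetCard 2 T).card = 3 := by
      intro T hT
      rw [Finset.card_powersetCard, (hmem T hT).2.1]
      rfl
    rw [Finset.sum_congr rfl this, Finset.sum_const, smul_eq_mul, mul_comm]
  rw [← hcard, ← Finset.card_powersetCard]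
  apply Finset.card_le_card
  intro P hP
  rw [Finset.mem_biUnion] at hP
  obtain ⟨T, hT, hPT⟩ := hP
  rw [Finset.mem_powersetCard] at hPT ⊢
  exact ⟨hPT.1.trans (hmem T hT).1, hPT.2⟩

open scoped Classical in
/-- **There are `s₃·(n − 3)` «rank-`2` triple + point» sets.** -/
theorem card_linePoint (hs : Simple M) (hC1 : ∀ L ⊆ gr M, M.eRk (L : Set α) = 2 → L.card ≤ 3) :
    (linePoint M).card = (rank2Triples M).card * ((gr M).card - 3) := by
  unfold linePoint
  have hmem : ∀ T ∈ rank2Triples M, T ⊆ gr M ∧ T.card = 3 ∧ M.eRk (T : Set α) ≤ 2 := by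
    intro T hT
    unfold rank2Triples at hT
    rw [Finset.mem_filter, Finset.mem_powerset] at hT
    exact ⟨hT.1, hT.2.1, hT.2.2⟩
  have hdisj : ((rank2Triples M : Finset (Finset α)) : Set (Finset α)).PairwiseDisjoint
      (fun T => (gr M \ T).image (fun x => insert x T)) := by
    intro T hT T' hT' hne
    rw [Function.onFun, Finset.disjoint_left]
    intro S hS hS'
    rw [Finset.mem_image] at hS hS'
    obtain ⟨x, hx, rfl⟩ := hS
    obtain ⟨x', hx', hxx'⟩ := hS'
    rw [Finset.mem_sdiff] at hx hx'
    obtain ⟨hTG, hTc, hTr⟩ := hmem T hT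
    obtain ⟨hT'G, hT'c, hT'r⟩ := hmem T' hT'
    have hSG : insert x T ⊆ gr M := Finset.insert_subset hx.1 hTG
    have hS4 : (insert x T).card = 4 := by rw [Finset.card_insert_of_notMem hx.2, hTc]
    have hTsub : T ⊆ insert x T := Finset.subset_insert x T
    have hT'sub : T' ⊆ insert x T := by rw [← hxx']; exact Finset.subset_insert x' T'
    exact hne (eq_of_rank_le_two_triples_global hs hC1 hSG hS4 hTsub hT'sub hTc hT'c hTr hT'r)
  rw [Finset.card_biUnion hdisj]
  have himg : ∀ T ∈ rank2Triples M, ((gr M \ T).image (fun x => insert x T)).card = (gr M).card - 3 := by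
    intro T hT
    obtain ⟨hTG, hTc, -⟩ := hmem T hT
    rw [Finset.card_image_of_injOn, Finset.card_sdiff_of_subset hTG, hTc]
    intro x hx x' hx' hxx'
    have hxx'' : insert x T = insert x' T := hxx'
    simp only [Finset.coe_sdiff, Set.mem_sdiff, Finset.mem_coe] at hx hx'
    have : x ∈ insert x' T := by rw [← hxx'']; exact Finset.mem_insert_self x T
    rw [Finset.mem_insert] at this
    rcases this with h | h
    · exact h
    · exact absurd h hx.2
  rw [Finset.sum_congr rfl himg, Finset.sum_const, smul_eq_mul]

open scoped Classical in
/-- The cyclic rank-`3` sets, plane by plane: `Λ₃ ≤ Σ_P cyc₃(P)` (each lies in its closure, a plane). -/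
theorem card_cyclic3_le_sum : (cyclic3 M).card ≤ ∑ P ∈ planes M, cyc3 M P := by
  have hmaps : ((cyclic3 M : Finset (Finset α)) : Set (Finset α)).MapsTo (fun S => clF M S) (planes M) := by
    intro S hS
    rw [Finset.mem_coe] at hS ⊢
    unfold cyclic3 at hS
    rw [Finset.mem_filter, Finset.mem_powerset] at hS
    exact (clF_mem_planes hS.1 hS.2.1).1
  rw [Finset.card_eq_sum_card_fiberwise hmaps]
  apply Finset.sum_le_sum
  intro P _
  unfold cyc3
  apply Finset.card_le_card
  intro S hS
  rw [Finset.mem_filter] at hS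
  obtain ⟨hS, hSP⟩ := hS
  unfold cyclic3 at hS
  rw [Finset.mem_filter, Finset.mem_powerset] at hS
  rw [Finset.mem_filter, Finset.mem_powerset]
  refine ⟨?_, hS.2.2.1, hS.2.2.2⟩
  rw [← hSP]
  exact (clF_mem_planes hS.1 hS.2.1).2

open scoped Classical in
/-- The rank-`3` triples, plane by plane: `Σ_P τ₃(P) = i₃` (each lies in exactly one plane, its closure). -/
theorem sum_tau3_eq : ∑ P ∈ planes M, tau3 M P = (rank3Triples M).card := by
  have hmaps : ((rank3Triples M : Finset (Finset α)) : Set (Finset α)).MapsTo (fun T => clF M T) (planes M) := by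
    intro T hT
    rw [Finset.mem_coe] at hT ⊢
    unfold rank3Triples at hT
    rw [Finset.mem_filter, Finset.mem_powerset] at hT
    exact (clF_mem_planes hT.1 hT.2.2).1
  rw [Finset.card_eq_sum_card_fiberwise hmaps]
  apply Finset.sum_congr rfl
  intro P hP
  unfold tau3
  congr 1
  ext T
  rw [Finset.mem_filter, Finset.mem_filter, Finset.mem_powerset]
  constructor
  · rintro ⟨hTP, hTc, hTr⟩
    have hPG : P ⊆ gr M := (mem_planes.1 hP).1
    refine ⟨?_, ?_⟩
    · unfold rank3Triples
      rw [Finset.mem_filter, Finset.mem_powerset]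
      exact ⟨hTP.trans hPG, hTc, hTr⟩
    · have h := closure_eq_of_subset_plane hP hTP hTr
      rw [← coe_clF] at h
      exact Finset.coe_injective h
  · rintro ⟨hT, hTP⟩
    unfold rank3Triples at hT
    rw [Finset.mem_filter, Finset.mem_powerset] at hT
    refine ⟨?_, hT.2.1, hT.2.2⟩
    rw [← hTP]
    exact (clF_mem_planes hT.1 hT.2.2).2

open scoped Classical in
/-- **`35·Λ₃ ≤ 64·i₃`** (Lemma ρ on every plane of the core). -/
theorem thirtyfive_mul_card_cyclic3_le (hs : Simple M)
    (hC1 : ∀ L ⊆ gr M, M.eRk (L : Set α) = 2 → L.card ≤ 3)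
    (hC2 : ∀ P ⊆ gr M, M.eRk (P : Set α) = 3 → P.card ≤ 7) :
    35 * (cyclic3 M).card ≤ 64 * (rank3Triples M).card := by
  calc 35 * (cyclic3 M).card ≤ 35 * ∑ P ∈ planes M, cyc3 M P := by gcongr; exact card_cyclic3_le_sum
    _ = ∑ P ∈ planes M, 35 * cyc3 M P := by rw [Finset.mul_sum]
    _ ≤ ∑ P ∈ planes M, 64 * tau3 M P := by
        apply Finset.sum_le_sum
        intro P hP
        obtain ⟨hPG, -, hPr⟩ := mem_planes.1 hP
        exact thirtyfive_mul_cyc3_le hs hPG hPr (fun T hT hr => hC1 T (hT.trans hPG) hr) (hC2 P hPG hPr)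
    _ = 64 * (rank3Triples M).card := by rw [← Finset.mul_sum, sum_tau3_eq]

open scoped Classical in
/-- **`s₃·(n − 3) ≤ C(n, 3)`**: `3·C(n,3) = C(n,2)·(n − 2)` and `3·s₃ ≤ C(n,2)`. -/
theorem card_linePoint_le (hs : Simple M) (hC1 : ∀ L ⊆ gr M, M.eRk (L : Set α) = 2 → L.card ≤ 3) :
    (linePoint M).card ≤ Nat.choose (gr M).card 3 := by
  rw [card_linePoint hs hC1]
  have h3 := three_mul_card_rank2Triples_le hs hC1
  have hid := Nat.choose_succ_right_eq (gr M).card 2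
  have : 3 * ((rank2Triples M).card * ((gr M).card - 3)) ≤ 3 * Nat.choose (gr M).card 3 := by
    calc 3 * ((rank2Triples M).card * ((gr M).card - 3))
        = (3 * (rank2Triples M).card) * ((gr M).card - 3) := by ring
      _ ≤ Nat.choose (gr M).card 2 * ((gr M).card - 3) := Nat.mul_le_mul_right _ h3
      _ ≤ Nat.choose (gr M).card 2 * ((gr M).card - 2) := Nat.mul_le_mul_left _ (by omega)
      _ = 3 * Nat.choose (gr M).card 3 := by rw [← hid]; ring
  omega

open scoped Classical in
/-- **`W₃ ≤ (2 + 64/35)·C(n, 3)`** in the form `35·W₃ ≤ 134·C(n,3)`. -/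
theorem thirtyfive_mul_card_rank3Sets_le (hs : Simple M)
    (hC1 : ∀ L ⊆ gr M, M.eRk (L : Set α) = 2 → L.card ≤ 3)
    (hC2 : ∀ P ⊆ gr M, M.eRk (P : Set α) = 3 → P.card ≤ 7) :
    35 * (rank3Sets M).card ≤ 134 * Nat.choose (gr M).card 3 := by
  have h1 : (rank3Sets M).card ≤ (rank3Triples M).card + (linePoint M).card + (cyclic3 M).card := by
    calc (rank3Sets M).card ≤ (rank3Triples M ∪ linePoint M ∪ cyclic3 M).card :=
          Finset.card_le_card (rank3Sets_subset hs hC1)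
      _ ≤ (rank3Triples M ∪ linePoint M).card + (cyclic3 M).card := Finset.card_union_le _ _
      _ ≤ (rank3Triples M).card + (linePoint M).card + (cyclic3 M).card := by
          gcongr; exact Finset.card_union_le _ _
  have h2 := card_rank3Triples_le (M := M)
  have h5 := thirtyfive_mul_card_cyclic3_le hs hC1 hC2
  have h6 := card_linePoint_le hs hC1
  omega

end CoreCount
end PercRepro
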